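import Mathlib
import Summits.AtomisticToContinuum.HydrodynamicLimit.Theorems.ImplosionDichotomyDenseExcursionPackingResolventGauges
import Summits.AtomisticToContinuum.HydrodynamicLimit.Theorems.ImplosionDichotomyDenseExcursionPackingResolventInnerPrimitive

/-!
# The packing-resolvent gain: the barrier bounds on `u₁`, `u₂` with all auxiliary objects eliminated
# (crux `DenseExcursion`, stmt-AtomisticToContinuum-12586, line `sonic-cavity-renewal` v8, stub `stub_packingResolventW`)

Helper file (`--supports stmt-AtomisticToContinuum-12586`) for the registered stub `stub_packingResolventW` (skeleton v8;
registered helper here: `packingResolventW_core`). For a differentiable real solution of the real resolvent system at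
real `Λ ≥ max(1000, 700B₀²)` with a continuous `(1 + S)`-weighted source of size `N` and finite global weighted sup, the
POINTWISE CONSEQUENCES of the barrier argument with the auxiliary objects eliminated: `|u₁| ≤ 33N` and `|u₂|/S ≤ 78N/Λ`
on `x ≤ x_Λ = log(2s₀/Λ)` (inner region: the primitive `H` of the `V`-source is built by `packingResolventW_innerPrimitive`
from the landed envelope `inner_h2_at`, the matching constant is `λ = V(x_Λ)/φ(2)` and `|λ| ≤ 16.2N` by
`packingResolventW_lamBound`), and `|u₁| ≤ (N/Λ)(2 + 87.5S)`, `|u₂| ≤ (N/Λ)(4 + 175S)/6` on `x ≥ x_Λ` (outer region), from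
the landed parameter-free barrier bounds `packingResolventW_gaugesLimit`.
-/

noncomputable section

open Set Filter Topology MeasureTheory intervalIntegral

namespace Summit.AtomisticToContinuum.HydrodynamicLimit.Theorems.PackingAnalyticImplosion

/-- **Registered helper `packingResolventW_core` of `stub_packingResolventW`: THE POINTWISE BARRIER BOUNDS ON `u₁, u₂`**
(see the module docstring; hypotheses: the digested tube, one bound `B₀` on `x ≥ 0`, the solution and its source).
[folklore] -/
theorem packingResolventW_core : ∀ (r Λ s₀ N N' B₀ : ℝ) (W S u₁ u₂ f₁ f₂ : ℝ → ℝ), 17307 / 15625 ≤ r → r ≤ 697 / 625 → 1000 ≤ Λ → 1 ≤ B₀ → 700 * B₀ ^ 2 ≤ Λ → 7 / 10 ≤ s₀ → s₀ ≤ 1 → 0 < N → (∀ x, 0 < S x) → Continuous W → Differentiable ℝ S → Differentiable ℝ u₁ → Differentiable ℝ u₂ → Continuous f₁ → Continuous f₂ → (∀ x, x ≤ 1 → |W x| ≤ 1 / 4 ∧ |deriv W x| ≤ 1 / 2 ∧ 7 / 10 ≤ Real.exp x * S x ∧ Real.exp x * S x ≤ 1) → (∀ x, x ≤ 0 → |W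 x - (r - 1)| ≤ Real.exp x ^ 2 / 10 + 2 * Real.exp x ^ 4 ∧ |deriv W x| ≤ Real.exp x ^ 2 / 5 + 2 * Real.exp x ^ 4 ∧ |Real.exp x * S x - s₀| ≤ Real.exp x ^ 2 / 10 + 2 * Real.exp x ^ 4 ∧ |Real.exp x * (S x + deriv S x)| ≤ Real.exp x ^ 2 / 5 + 2 * Real.exp x ^ 4) → (∀ x, x ≤ 0 → |S x + deriv S x| ≤ 11 / 5) → (∀ x, x < 0 → 1 < W x + S x) → (∀ x, 0 ≤ x → W x + S x ≤ 1) → (∀ x, 0 ≤ x → |W x| ≤ B₀ ∧ |deriv W x| ≤ B₀ ∧ S x ≤ B₀ ∧ |deriv S x| ≤ B₀) → (∀ x y, x ≤ y → y ≤ 1 → S y ≤ S x) → (∀ x, Λ * u₁ x - ((W x - 1) * deriv u₁ x + 3 * S x * deriv u₂ x + (deriv W x + 2 * W x - r) * u₁ x + (3 * deriv S x + 6 * S x) * u₂ x) = f₁ x ∧ Λ * u₂ x - (S x / 3 * deriv u₁ x + (W x - 1) * deriv u₂ x + (deriv S x + 2 * S x) * u₁ x + (deriv W x / 3 + 2 *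 W x - r) * u₂ x) = f₂ x) → (∀ y, |f₁ y| / (1 + S y) + |f₂ y| / S y ≤ N) → (∀ y, |u₁ y| + |u₂ y| / S y ≤ N') → (∀ x, x ≤ Real.log (2 * s₀ / Λ) → |u₁ x| ≤ 33 * N ∧ |u₂ x| / S x ≤ 78 * N / Λ) ∧ (∀ x, Real.log (2 * s₀ / Λ) ≤ x → |u₁ x| ≤ N / Λ * (2 + 875 / 10 * S x) ∧ |u₂ x| ≤ N / Λ * (4 + 175 * S x) / 6) := by
  intro r Λ s₀ N N' B₀ W S u₁ u₂ f₁ f₂ hr1 hr2 hΛ hB hΛB hs₀ hs₀' hN hSpos hWc hSd hu₁ hu₂ hf₁c hf₂c htc htd hτ hsup hsub hB0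
    hSanti heq hf hN'
  have hΛpos : 0 < Λ := by linarith
  have hs0 : 0 < s₀ := by linarith
  have hSc : Continuous S := hSd.continuous
  -- `δ = 1/Λ`, `x_Λ = log(2 s₀/Λ)`
  obtain ⟨δ, hδ_def⟩ : ∃ δ : ℝ, δ = 1 / Λ := ⟨_, rfl⟩
  have hδΛ : δ * Λ = 1 := by rw [hδ_def]; field_simp
  have hδ : 0 < δ := by rw [hδ_def]; positivity
  have hδ' : δ ≤ 1 / 1000 := by rw [hδ_def]; exact div_le_div_of_nonneg_left (by norm_num) (by norm_num) hΛ
  obtain ⟨xL, hxL_def⟩ : ∃ xL : ℝ, xL = Real.log (2 * s₀ / Λ) := ⟨_, rfl⟩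
  have hxL : Real.exp xL = 2 * s₀ / Λ := by rw [hxL_def]; exact Real.exp_log (by positivity)
  have hxLneg : xL < 0 := by
    have h1 : Real.exp xL < 1 := by rw [hxL, div_lt_one hΛpos]; linarith
    exact Real.exp_lt_one_iff.1 h1
  rw [← hxL_def]
  have htc3 : ∀ x, x ≤ 1 → |W x| ≤ 1 / 4 ∧ 7 / 10 ≤ Real.exp x * S x ∧ Real.exp x * S x ≤ 1 :=
    fun x hx => ⟨(htc x hx).1, (htc x hx).2.2.1, (htc x hx).2.2.2⟩
  -- the `V`-source, its continuity on the core, its envelope and its primitive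
  have hDen : ∀ y, y < 0 → 0 < S y ^ 2 - (1 - W y) ^ 2 := by
    intro y hy
    have h1 := hsup y hy
    have h2 := (abs_le.1 (htc y (by linarith)).1).2
    have h3 : 0 < S y := hSpos y
    have e : S y ^ 2 - (1 - W y) ^ 2 = (S y - (1 - W y)) * (S y + (1 - W y)) := by ring
    rw [e]
    exact mul_pos (by linarith) (by linarith)
  have hcont : ContinuousOn (fun y => (-(Λ * Real.exp y ^ 2 * S y * ((1 - W y) * f₂ y + S y * f₁ y / 3)) / (s₀ ^ 2 * (S y ^ 2 - (1 - W y) ^ 2)))) (Iio 0) := by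
    refine ContinuousOn.div (Continuous.continuousOn (by fun_prop)) (Continuous.continuousOn (by fun_prop)) fun y hy => ?_
    have := hDen y hy
    positivity
  have hbound : ∀ y, y ≤ xL → |(-(Λ * Real.exp y ^ 2 * S y * ((1 - W y) * f₂ y + S y * f₁ y / 3)) / (s₀ ^ 2 * (S y ^ 2 - (1 - W y) ^ 2)))| ≤ N * (17 / 50 * (Λ / s₀ * Real.exp y) + (Λ / s₀ * Real.exp y) ^ 2 / 100) :=
    fun y hy => inner_h2_at hr1 hr2 hδΛ hδ hδ' hs₀ hs₀' hxL hSpos htc3 htd hN.le hf hy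
  have hcpos : 0 < Λ / s₀ := by positivity
  have hcL : Λ / s₀ * Real.exp xL = 2 := by rw [hxL]; field_simp
  obtain ⟨hHd, hH0⟩ := packingResolventW_innerPrimitive (fun y => (-(Λ * Real.exp y ^ 2 * S y * ((1 - W y) * f₂ y + S y * f₁ y / 3)) / (s₀ ^ 2 * (S y ^ 2 - (1 - W y) ^ 2)))) xL (Λ / s₀) N hxLneg hcpos hcL.le hN.le hcont hbound
  -- the matching constant
  obtain ⟨lam, hlam_def⟩ : ∃ lam : ℝ, lam = (Λ * Real.exp xL ^ 2 * S xL * u₂ xL / s₀ ^ 2) / (94253 / 51975) := ⟨_, rfl⟩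
  have hlam : lam * (94253 / 51975) = (Λ * Real.exp xL ^ 2 * S xL * u₂ xL / s₀ ^ 2) := by rw [hlam_def]; exact div_mul_cancel₀ _ (by norm_num)
  -- the parameter-free barrier bounds
  obtain ⟨hin, hout⟩ := packingResolventW_gaugesLimit r Λ δ s₀ N N' lam xL B₀ W S u₁ u₂ f₁ f₂
    (fun u => ∫ t in xL..u, (-(Λ * Real.exp t ^ 2 * S t * ((1 - W t) * f₂ t + S t * f₁ t / 3)) / (s₀ ^ 2 * (S t ^ 2 - (1 - W t) ^ 2)))) hr1 hr2 hδΛ hδ hδ' hB hΛB hs₀ hs₀' hxL hN hSpos hSd hu₁ hu₂ htc htd hτ hsup hsub hB0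
    hSanti heq hf hN' (fun x hx => hHd x hx) hH0 hlam
  -- the matching constant is `O(N)`
  have hlamB : |lam| ≤ 162 / 10 * N := by
    obtain ⟨-, -, -, -, hst1, hst2, hst0, -⟩ := inner_atoms_at hδΛ hδ hδ' hs₀ hs₀' hxL htc3 htd (le_refl xL)
    have heΛ : Real.exp xL * Λ = 2 * s₀ := by rw [hxL]; field_simp
    have hPM : |u₁ xL + 3 * u₂ xL| + |u₁ xL - 3 * u₂ xL| ≤ 1 * (N / Λ * (4 + 175 * S xL) + 2 * (0 * Real.exp xL)) := by
      calc _ ≤ N / Λ * (2 + 100 * S xL) + N / Λ * (2 + 75 * S xL) := add_le_add (hout xL le_rfl).1 (hout xL le_rfl).2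
        _ = _ := by ring
    have := (packingResolventW_lamBound Λ δ s₀ N 0 1 (Real.exp xL) (S xL) (u₁ xL + 3 * u₂ xL) (u₁ xL - 3 * u₂ xL) lam
      hδΛ hδ hδ' hs₀ hs₀' heΛ hst1 hst2 hst0 hN le_rfl hN.le zero_le_one hPM (by rw [hlam]; ring)).1
    linarith
  -- ===== unpack =====
  constructor
  · intro x hx
    obtain ⟨he, he2, heΛ, -, hst1, hst2, -, -, -, -, -, -, hρ0, hρ2⟩ := inner_atoms_at hδΛ hδ hδ' hs₀ hs₀' hxL htc3 htd hx
    obtain ⟨hΦ1, hΦ2, hΦ3, hΨ1, hΨ2⟩ := besselPhi5_bounds hρ0.le hρ2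
    obtain ⟨hU, hZ⟩ := hin x hx
    have hSx := hSpos x
    constructor
    · -- `|u₁| ≤ |U| + |λ| ψ ≤ 9N + 16.2·1.47 N`
      have h1 : |u₁ x| ≤ |u₁ x - lam * (1 + (Λ / s₀ * Real.exp x) ^ 2 / 10 + (Λ / s₀ * Real.exp x) ^ 4 / 280 + (Λ / s₀ * Real.exp x) ^ 6 / 15120 + (Λ / s₀ * Real.exp x) ^ 8 / 1330560)| + |lam * (1 + (Λ / s₀ * Real.exp x) ^ 2 / 10 + (Λ / s₀ * Real.exp x) ^ 4 / 280 + (Λ / s₀ * Real.exp x) ^ 6 / 15120 + (Λ / s₀ * Real.exp x) ^ 8 / 1330560)| := by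
        have := abs_add_le (u₁ x - lam * (1 + (Λ / s₀ * Real.exp x) ^ 2 / 10 + (Λ / s₀ * Real.exp x) ^ 4 / 280 + (Λ / s₀ * Real.exp x) ^ 6 / 15120 + (Λ / s₀ * Real.exp x) ^ 8 / 1330560)) (lam * (1 + (Λ / s₀ * Real.exp x) ^ 2 / 10 + (Λ / s₀ * Real.exp x) ^ 4 / 280 + (Λ / s₀ * Real.exp x) ^ 6 / 15120 + (Λ / s₀ * Real.exp x) ^ 8 / 1330560))
        rwa [sub_add_cancel] at this
      have h2 : |lam * (1 + (Λ / s₀ * Real.exp x) ^ 2 / 10 + (Λ / s₀ * Real.exp x) ^ 4 / 280 + (Λ / s₀ * Real.exp x) ^ 6 / 15120 + (Λ / s₀ * Real.exp x) ^ 8 / 1330560)| ≤ 162 / 10 * N * (147 / 100) := by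
        rw [abs_mul, abs_of_nonneg (by linarith : (0:ℝ) ≤ (1 + (Λ / s₀ * Real.exp x) ^ 2 / 10 + (Λ / s₀ * Real.exp x) ^ 4 / 280 + (Λ / s₀ * Real.exp x) ^ 6 / 15120 + (Λ / s₀ * Real.exp x) ^ 8 / 1330560))]
        exact mul_le_mul hlamB hΨ2 (by linarith) (by positivity)
      linarith
    · -- `|u₂|/S = |V| s₀²/(Λ (eS)²) ≤ |V|/(0.49 Λ)`, `|V| ≤ |Z| + |H| + |λ| φ ≤ 38 N`
      have hV : |(Λ * Real.exp x ^ 2 * S x * u₂ x / s₀ ^ 2)| ≤ 38 * N := by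
        have h1 : |(Λ * Real.exp x ^ 2 * S x * u₂ x / s₀ ^ 2)| ≤ |(Λ * Real.exp x ^ 2 * S x * u₂ x / s₀ ^ 2) - (∫ t in xL..x, (-(Λ * Real.exp t ^ 2 * S t * ((1 - W t) * f₂ t + S t * f₁ t / 3)) / (s₀ ^ 2 * (S t ^ 2 - (1 - W t) ^ 2)))) - lam * (1 + (Λ / s₀ * Real.exp x) ^ 2 / 6 + (Λ / s₀ * Real.exp x) ^ 4 / 120 + (Λ / s₀ * Real.exp x) ^ 6 / 5040 + (Λ / s₀ * Real.exp x) ^ 8 / 362880 + (Λ / s₀ * Real.exp x) ^ 10 / 39916800)| +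
            |∫ t in xL..x, (-(Λ * Real.exp t ^ 2 * S t * ((1 - W t) * f₂ t + S t * f₁ t / 3)) / (s₀ ^ 2 * (S t ^ 2 - (1 - W t) ^ 2)))| + |lam * (1 + (Λ / s₀ * Real.exp x) ^ 2 / 6 + (Λ / s₀ * Real.exp x) ^ 4 / 120 + (Λ / s₀ * Real.exp x) ^ 6 / 5040 + (Λ / s₀ * Real.exp x) ^ 8 / 362880 + (Λ / s₀ * Real.exp x) ^ 10 / 39916800)| := by
          have := abs_add_three ((Λ * Real.exp x ^ 2 * S x * u₂ x / s₀ ^ 2) - (∫ t in xL..x, (-(Λ * Real.exp t ^ 2 * S t * ((1 - W t) * f₂ t + S t * f₁ t / 3)) / (s₀ ^ 2 * (S t ^ 2 - (1 - W t) ^ 2)))) - lam * (1 + (Λ / s₀ * Real.exp x) ^ 2 / 6 + (Λ / s₀ * Real.exp x) ^ 4 / 120 + (Λ / s₀ * Real.exp x) ^ 6 / 5040 + (Λ / s₀ * Real.exp x) ^ 8 / 362880 + (Λ / s₀ * Real.exp x) ^ 10 / 39916800))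
            (∫ t in xL..x, (-(Λ * Real.exp t ^ 2 * S t * ((1 - W t) * f₂ t + S t * f₁ t / 3)) / (s₀ ^ 2 * (S t ^ 2 - (1 - W t) ^ 2)))) (lam * (1 + (Λ / s₀ * Real.exp x) ^ 2 / 6 + (Λ / s₀ * Real.exp x) ^ 4 / 120 + (Λ / s₀ * Real.exp x) ^ 6 / 5040 + (Λ / s₀ * Real.exp x) ^ 8 / 362880 + (Λ / s₀ * Real.exp x) ^ 10 / 39916800))
          rwa [show (Λ * Real.exp x ^ 2 * S x * u₂ x / s₀ ^ 2) - (∫ t in xL..x, (-(Λ * Real.exp t ^ 2 * S t * ((1 - W t) * f₂ t + S t * f₁ t / 3)) / (s₀ ^ 2 * (S t ^ 2 - (1 - W t) ^ 2)))) - lam * (1 + (Λ / s₀ * Real.exp x) ^ 2 / 6 + (Λ / s₀ * Real.exp x) ^ 4 / 120 + (Λ / s₀ * Real.exp x) ^ 6 / 5040 + (Λ / s₀ * Real.exp x) ^ 8 / 362880 + (Λ / s₀ * Real.exp x) ^ 10 / 39916800) + (∫ t in xL..x, (-(Λ * Real.exp t ^ 2 * S t * ((1 - W t) * f₂ t + S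 t * f₁ t / 3)) / (s₀ ^ 2 * (S t ^ 2 - (1 - W t) ^ 2)))) +
            lam * (1 + (Λ / s₀ * Real.exp x) ^ 2 / 6 + (Λ / s₀ * Real.exp x) ^ 4 / 120 + (Λ / s₀ * Real.exp x) ^ 6 / 5040 + (Λ / s₀ * Real.exp x) ^ 8 / 362880 + (Λ / s₀ * Real.exp x) ^ 10 / 39916800) = (Λ * Real.exp x ^ 2 * S x * u₂ x / s₀ ^ 2) by ring] at this
        have h2 : |lam * (1 + (Λ / s₀ * Real.exp x) ^ 2 / 6 + (Λ / s₀ * Real.exp x) ^ 4 / 120 + (Λ / s₀ * Real.exp x) ^ 6 / 5040 + (Λ / s₀ * Real.exp x) ^ 8 / 362880 + (Λ / s₀ * Real.exp x) ^ 10 / 39916800)| ≤ 162 / 10 * N * (182 / 100) := by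
          rw [abs_mul, abs_of_nonneg (by linarith : (0:ℝ) ≤ (1 + (Λ / s₀ * Real.exp x) ^ 2 / 6 + (Λ / s₀ * Real.exp x) ^ 4 / 120 + (Λ / s₀ * Real.exp x) ^ 6 / 5040 + (Λ / s₀ * Real.exp x) ^ 8 / 362880 + (Λ / s₀ * Real.exp x) ^ 10 / 39916800))]
          exact mul_le_mul hlamB (hΦ2.trans hΦ3) (by linarith) (by positivity)
        have h3 : 17 / 10 * N * (401 / 100 - (Λ / s₀ * Real.exp x) ^ 2) ≤ 17 / 10 * N * (401 / 100) := by
          apply mul_le_mul_of_nonneg_left _ (by positivity)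
          linarith [sq_nonneg (Λ / s₀ * Real.exp x)]
        linarith [(hHd x hx).2]
      have h4 : |u₂ x| / S x * (Λ * (S x * Real.exp x) ^ 2) = |(Λ * Real.exp x ^ 2 * S x * u₂ x / s₀ ^ 2)| * s₀ ^ 2 := by
        rw [abs_div, abs_of_pos (by positivity : (0:ℝ) < s₀ ^ 2), abs_mul,
          abs_of_pos (by positivity : (0:ℝ) < Λ * Real.exp x ^ 2 * S x)]
        field_simp
      have h5 : 49 / 100 * Λ ≤ Λ * (S x * Real.exp x) ^ 2 := by
        have : 49 / 100 ≤ (S x * Real.exp x) ^ 2 := by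
          calc (49 / 100 : ℝ) = (7 / 10) ^ 2 := by norm_num
            _ ≤ (S x * Real.exp x) ^ 2 := pow_le_pow_left₀ (by norm_num) hst1 2
        nlinarith only [this, hΛpos]
      have h6 : |u₂ x| / S x * (49 / 100 * Λ) ≤ 38 * N := by
        calc |u₂ x| / S x * (49 / 100 * Λ) ≤ |u₂ x| / S x * (Λ * (S x * Real.exp x) ^ 2) :=
              mul_le_mul_of_nonneg_left h5 (div_nonneg (abs_nonneg _) hSx.le)
          _ = |(Λ * Real.exp x ^ 2 * S x * u₂ x / s₀ ^ 2)| * s₀ ^ 2 := h4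
          _ ≤ 38 * N * s₀ ^ 2 := mul_le_mul_of_nonneg_right hV (by positivity)
          _ ≤ 38 * N * 1 := by
              apply mul_le_mul_of_nonneg_left _ (by positivity)
              calc s₀ ^ 2 ≤ 1 ^ 2 := pow_le_pow_left₀ hs0.le hs₀' 2
                _ = 1 := by ring
          _ = 38 * N := by ring
      rw [le_div_iff₀ hΛpos]
      have e1 : |u₂ x| / S x * (49 / 100 * Λ) = 49 / 100 * (|u₂ x| / S x * Λ) := by ring
      rw [e1] at h6
      linarith
  · intro x hx
    obtain ⟨hP, hM⟩ := hout x hx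
    constructor
    · have h1 : |u₁ x| = |((u₁ x + 3 * u₂ x) + (u₁ x - 3 * u₂ x))| / 2 := by
        rw [show (u₁ x + 3 * u₂ x) + (u₁ x - 3 * u₂ x) = 2 * u₁ x by ring, abs_mul, abs_of_pos (by norm_num : (0:ℝ) < 2)]
        ring
      rw [h1, div_le_iff₀ (by norm_num : (0:ℝ) < 2)]
      have h2 := abs_add_le (u₁ x + 3 * u₂ x) (u₁ x - 3 * u₂ x)
      have e2 : N / Λ * (2 + 875 / 10 * S x) * 2 = N / Λ * (2 + 100 * S x) + N / Λ * (2 + 75 * S x) := by ring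
      rw [e2]
      exact h2.trans (add_le_add hP hM)
    · have h1 : |u₂ x| = |((u₁ x + 3 * u₂ x) - (u₁ x - 3 * u₂ x))| / 6 := by
        rw [show (u₁ x + 3 * u₂ x) - (u₁ x - 3 * u₂ x) = 6 * u₂ x by ring, abs_mul, abs_of_pos (by norm_num : (0:ℝ) < 6)]
        ring
      rw [h1, div_le_div_iff_of_pos_right (by norm_num : (0:ℝ) < 6)]
      have h2 := abs_sub (u₁ x + 3 * u₂ x) (u₁ x - 3 * u₂ x)
      have e2 : N / Λ * (4 + 175 * S x) = N / Λ * (2 + 100 * S x) + N / Λ * (2 + 75 * S x) := by ring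
      rw [e2]
      exact h2.trans (add_le_add hP hM)

end Summit.AtomisticToContinuum.HydrodynamicLimit.Theorems.PackingAnalyticImplosion

end
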